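import Mathlib.GroupTheory.OrderOfElement
import Mathlib.Algebra.Group.Pointwise.Set.Card
import Mathlib.Algebra.Order.BigOperators.Group.Finset
import Mathlib.Data.Set.Card
import Mathlib.NumberTheory.Padics.PadicVal.Basic
import Mathlib.Analysis.SpecificLimits.Basic
import HarnessLib

/-!
# Eigenspaces of an endomorphism of a `p`-primary abelian group with finite `p`-torsion, I: torsion levels `#D[p^k] ≤ #D[p]^k`,
# finiteness of `{y : c • y = 0}`, and the operators `∏ (Φ − w)` (proofs only; part II = `…RlfPrimaryTorsionEigenFinite`)

Route `ResidualThetaTransportAtTwo` (RTT, crux r201, stmt-BirchSwinnertonDyer-23110) / `ThetaPartnerAtTwo`; seat `prover-bsd-wall-tp2-p2x` g12 LEAD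
(`--supports stmt-BirchSwinnertonDyer-23110`). PURE ALGEBRA, THEOREMS ONLY (no definition, no named fact, no `sorry`); namespace
`Summit.BirchSwinnertonDyer.BirchSwinnertonDyer.Theorems.SignedEC.PrimaryTorsionEigen`. The local half of the input `hfinE` of
`TwistedPT.hlevEventual_two_of_plusDualNondeg_of_eigen` (the `u^{N_v}`-eigenclasses of the local factors `Y_v`, `v ∈ S₀`).

Classical fact behind Greenberg's «`𝒫_E^{(v)}(F_∞)` is `Λ`-cotorsion if `v ∤ p`» (LNM 1716, §4 p. 113), in the elementary form
"a `p`-primary abelian group `D` with FINITE `p`-torsion `D[p]` and an additive endomorphism `Φ` has only finitely many integers `w` with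
infinite eigenspace `S_w = {y : Φ y = w • y}`" — indeed `p^m ≤ #D[p]` whenever `m` distinct integers have infinite eigenspaces.
Elementary counting (no structure theory, no duality): `#D[p^k] ≤ #D[p]^k`; an infinite eigenspace meets `D[p^k]` in `≥ p^k` elements
(it contains elements of every order `p^k`); eigenspaces for distinct integers are independent up to a bounded finite error
(`S_{w'} ∩ ∑_{w ∈ L} S_w` is killed by `∏_{w ∈ L} (w' − w) ≠ 0`, and `{y : c • y = 0}` is finite for `c ≠ 0`); hence
`p^{mk} ≤ C · #D[p]^k` for all `k`, forcing `p^m ≤ #D[p]`.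

* `finite_torsionBy_pow`, `ncard_torsionBy_pow_le` — `D[p^k]` finite, `#D[p^k] ≤ #D[p]^k`;
* `finite_setOf_zsmul_eq_zero` — `{y : c • y = 0}` finite for `c ≠ 0`;
* `pow_le_ncard_of_infinite_eigenspaces` — a duplicate-free list of `m` integers with infinite eigenspaces forces `p^m ≤ #D[p]`;
* **`finite_setOf_infinite_eigenspace`** — `{w : ℤ | {y | Φ y = w • y}.Infinite}.Finite`.

References: R. Greenberg, LNM 1716 (1999), §4 p. 113 [GreenbergLNM1716]; R. Greenberg, V. Vatsal, Invent. math. 142 (2000), §2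
Prop. (2.4) [GreenbergVatsal2000]; L. Fuchs, *Infinite Abelian Groups* I (1970), §25. [folklore]
-/

set_option autoImplicit false

noncomputable section

open scoped Classical Pointwise

-- the Theorems namespace of this sub repeats the summit name by design (D-0017 nested layout)
set_option linter.dupNamespace false

namespace Summit.BirchSwinnertonDyer.BirchSwinnertonDyer.Theorems.SignedEC.PrimaryTorsionEigen

variable {D : Type*} [AddCommGroup D] {p : ℕ} [hp : Fact p.Prime] (Φ : D →+ D)

/-! ## §1 Torsion levels: `D[p^k]` is finite with `#D[p^k] ≤ #D[p]^k` -/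

omit hp in
/-- A fibre `{y : p • y = b}` of multiplication by `p` is a translate of `D[p]` (or empty), hence finite if `D[p]` is. [folklore] -/
theorem finite_fiber_nsmul (hfin : {y : D | p • y = 0}.Finite) (b : D) : {y : D | p • y = b}.Finite := by
  by_cases hb : ∃ y₀ : D, p • y₀ = b
  · obtain ⟨y₀, hy₀⟩ := hb
    refine (hfin.image fun t ↦ t + y₀).subset fun y hy ↦ ?_
    refine ⟨y - y₀, ?_, sub_add_cancel y y₀⟩
    simp only [Set.mem_setOf_eq] at hy ⊢
    rw [smul_sub, hy, hy₀, sub_self]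
  · have : {y : D | p • y = b} = ∅ := Set.eq_empty_of_forall_notMem fun y hy ↦ hb ⟨y, hy⟩
    rw [this]; exact Set.finite_empty

omit hp in
/-- The `p`-fibre over `b` has at most `#D[p]` elements. [folklore] -/
theorem ncard_fiber_nsmul_le (hfin : {y : D | p • y = 0}.Finite) (b : D) :
    {y : D | p • y = b}.ncard ≤ {y : D | p • y = 0}.ncard := by
  by_cases hb : ∃ y₀ : D, p • y₀ = b
  · obtain ⟨y₀, hy₀⟩ := hb
    have hsub : {y : D | p • y = b} ⊆ (fun t ↦ t + y₀) '' {y : D | p • y = 0} := fun y hy ↦ by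
      refine ⟨y - y₀, ?_, sub_add_cancel y y₀⟩
      simp only [Set.mem_setOf_eq] at hy ⊢
      rw [smul_sub, hy, hy₀, sub_self]
    exact (Set.ncard_le_ncard hsub (hfin.image _)).trans (Set.ncard_image_le hfin)
  · have : {y : D | p • y = b} = ∅ := Set.eq_empty_of_forall_notMem fun y hy ↦ hb ⟨y, hy⟩
    rw [this, Set.ncard_empty]; exact Nat.zero_le _

omit hp in
/-- **`D[p^k]` is finite and `#D[p^k] ≤ #D[p]^k`** when `D[p]` is finite. [folklore] -/
theorem finite_and_ncard_torsionBy_pow_le (hfin : {y : D | p • y = 0}.Finite) (k : ℕ) :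
    {y : D | p ^ k • y = 0}.Finite ∧ {y : D | p ^ k • y = 0}.ncard ≤ {y : D | p • y = 0}.ncard ^ k := by
  induction k with
  | zero =>
    have h0 : {y : D | p ^ 0 • y = 0} = {0} := by ext y; simp
    rw [h0]; exact ⟨Set.finite_singleton 0, by rw [Set.ncard_singleton, pow_zero]⟩
  | succ k ih =>
    obtain ⟨hfk, hck⟩ := ih
    have hpre : {y : D | p ^ (k + 1) • y = 0} = (fun y : D ↦ p • y) ⁻¹' {y : D | p ^ k • y = 0} := by
      ext y; simp only [Set.mem_setOf_eq, Set.mem_preimage]; rw [← mul_smul, ← pow_succ]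
    have hfk1 : {y : D | p ^ (k + 1) • y = 0}.Finite := by
      rw [hpre]
      exact hfk.preimage' fun b _ ↦ finite_fiber_nsmul hfin b
    refine ⟨hfk1, ?_⟩
    -- count through the fibres of `y ↦ p • y`
    set s := hfk1.toFinset with hs
    have hcard : s.card ≤ {y : D | p • y = 0}.ncard * (s.image fun y : D ↦ p • y).card := by
      refine Finset.card_le_mul_card_image _ _ fun b _ ↦ ?_
      calc (s.filter fun y ↦ p • y = b).card
          = ((s.filter fun y ↦ p • y = b : Finset D) : Set D).ncard := (Set.ncard_coe_finset _).symm
        _ ≤ {y : D | p • y = b}.ncard :=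
            Set.ncard_le_ncard (fun y hy ↦ (Finset.mem_filter.1 hy).2) (finite_fiber_nsmul hfin b)
        _ ≤ {y : D | p • y = 0}.ncard := ncard_fiber_nsmul_le hfin b
    have himg : ((s.image fun y : D ↦ p • y : Finset D) : Set D) ⊆ {y : D | p ^ k • y = 0} := by
      intro b hb
      rw [Finset.coe_image] at hb
      obtain ⟨y, hy, rfl⟩ := hb
      have hy' : y ∈ {y : D | p ^ (k + 1) • y = 0} := (Set.Finite.mem_toFinset hfk1).1 hy
      rw [hpre] at hy'; exact hy'
    have himg' : (s.image fun y : D ↦ p • y).card ≤ {y : D | p ^ k • y = 0}.ncard := by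
      rw [← Set.ncard_coe_finset]; exact Set.ncard_le_ncard himg hfk
    calc {y : D | p ^ (k + 1) • y = 0}.ncard = s.card := by rw [hs, Set.ncard_eq_toFinset_card _ hfk1]
      _ ≤ {y : D | p • y = 0}.ncard * {y : D | p ^ k • y = 0}.ncard :=
          hcard.trans (Nat.mul_le_mul_left _ himg')
      _ ≤ {y : D | p • y = 0}.ncard * {y : D | p • y = 0}.ncard ^ k := Nat.mul_le_mul_left _ hck
      _ = {y : D | p • y = 0}.ncard ^ (k + 1) := by rw [pow_succ, mul_comm]

/-- **`{y : c • y = 0}` is finite for `c ≠ 0`** in a `p`-primary group with finite `p`-torsion: `c • y = 0` and `p^n • y = 0` give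
`p^j • y = 0` for `p^j = gcd(c, p^n)`, and `j ≤ v_p(c)`. [folklore] -/
theorem finite_setOf_zsmul_eq_zero (htor : ∀ y : D, ∃ n : ℕ, p ^ n • y = 0) (hfin : {y : D | p • y = 0}.Finite) {c : ℤ}
    (hc : c ≠ 0) : {y : D | c • y = 0}.Finite := by
  refine (finite_and_ncard_torsionBy_pow_le hfin (padicValInt p c)).1.subset fun y hy ↦ ?_
  simp only [Set.mem_setOf_eq] at hy ⊢
  obtain ⟨n, hn⟩ := htor y
  -- `g = gcd(c, p^n)` kills `y`
  set g : ℕ := Int.gcd c ((p : ℤ) ^ n) with hg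
  have hgy : (g : ℤ) • y = 0 := by
    rw [hg, Int.gcd_eq_gcd_ab c ((p : ℤ) ^ n), add_smul, mul_comm c, mul_smul, hy, smul_zero, zero_add, mul_comm,
      mul_smul, ← Nat.cast_pow, natCast_zsmul, hn, smul_zero]
  -- `g ∣ p^n`, so `g = p^j` with `p^j ∣ c`, hence `j ≤ v_p(c)`
  have hgdvd : g ∣ p ^ n := by
    have h : (g : ℤ) ∣ ((p : ℤ) ^ n) := Int.gcd_dvd_right _ _
    rw [← Nat.cast_pow] at h
    exact Int.natCast_dvd_natCast.1 h
  obtain ⟨j, -, hj⟩ := (Nat.dvd_prime_pow hp.out).1 hgdvd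
  have hjc : ((p : ℤ) ^ j) ∣ c := by
    have h : (g : ℤ) ∣ c := Int.gcd_dvd_left _ _
    rw [hj, Nat.cast_pow] at h
    exact h
  have hjle : j ≤ padicValInt p c := (padicValInt_dvd_iff j c).1 hjc |>.resolve_left hc
  obtain ⟨d, hd⟩ := Nat.exists_eq_add_of_le hjle
  rw [hd, pow_add, mul_comm, mul_smul]
  have hjy : p ^ j • y = 0 := by
    rw [← natCast_zsmul, Nat.cast_pow, ← Nat.cast_pow, ← hj]; exact hgy
  rw [hjy, smul_zero]

/-! ## §2 Eigenspaces: the operators `∏ (Φ − w)` -/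

/-- On an eigenvector `Φ y = w' • y` the composite `∏_{w ∈ L} (Φ − w)` acts by the integer `∏_{w ∈ L} (w' − w)`. [folklore] -/
theorem foldr_apply_of_eigen (L : List ℤ) {w' : ℤ} {y : D} (hy : Φ y = w' • y) :
    (L.foldr (fun w (f : D →+ D) ↦ f.comp (Φ - w • AddMonoidHom.id D)) (AddMonoidHom.id D)) y =
      (L.map fun w ↦ w' - w).prod • y := by
  induction L generalizing y with
  | nil => simp
  | cons w L ih =>
    rw [List.foldr_cons, AddMonoidHom.comp_apply, List.map_cons, List.prod_cons]
    have h1 : (Φ - w • AddMonoidHom.id D) y = (w' - w) • y := by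
      rw [AddMonoidHom.sub_apply, AddMonoidHom.smul_apply, AddMonoidHom.id_apply, hy, sub_smul]
    rw [h1, ih (by rw [map_zsmul, hy, smul_comm]), smul_smul, mul_comm]

/-- The composite `∏_{w ∈ L} (Φ − w)` kills the subgroup `∑_{w ∈ L} S_w` generated by the eigenspaces of the `w ∈ L`. [folklore] -/
theorem foldr_apply_eq_zero_of_mem (L : List ℤ) {y : D}
    (hy : y ∈ L.foldr (fun w (H : AddSubgroup D) ↦ (Φ - w • AddMonoidHom.id D).ker ⊔ H) ⊥) :
    (L.foldr (fun w (f : D →+ D) ↦ f.comp (Φ - w • AddMonoidHom.id D)) (AddMonoidHom.id D)) y = 0 := by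
  -- the subgroups `∑ S_w` are `Φ`-stable
  have hstab : ∀ (L : List ℤ) (y : D), y ∈ L.foldr (fun w (H : AddSubgroup D) ↦ (Φ - w • AddMonoidHom.id D).ker ⊔ H) ⊥ →
      Φ y ∈ L.foldr (fun w (H : AddSubgroup D) ↦ (Φ - w • AddMonoidHom.id D).ker ⊔ H) ⊥ := by
    intro L
    induction L with
    | nil => intro y hy; rw [List.foldr_nil, AddSubgroup.mem_bot] at hy; rw [List.foldr_nil, hy, map_zero]; exact zero_mem _
    | cons w L ih =>
      intro y hy
      rw [List.foldr_cons, AddSubgroup.mem_sup] at hy ⊢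
      obtain ⟨a, ha, b, hb, rfl⟩ := hy
      refine ⟨Φ a, ?_, Φ b, ih b hb, (map_add Φ a b).symm⟩
      rw [AddMonoidHom.mem_ker, AddMonoidHom.sub_apply, AddMonoidHom.smul_apply, AddMonoidHom.id_apply, sub_eq_zero] at ha ⊢
      rw [ha, map_zsmul, ha]
  induction L generalizing y with
  | nil => rw [List.foldr_nil, AddSubgroup.mem_bot] at hy; rw [hy, map_zero]
  | cons w L ih =>
    rw [List.foldr_cons, AddSubgroup.mem_sup] at hy
    obtain ⟨a, ha, b, hb, rfl⟩ := hy
    rw [List.foldr_cons, AddMonoidHom.comp_apply, map_add, (AddMonoidHom.mem_ker).1 ha, zero_add]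
    refine ih ?_
    rw [AddMonoidHom.sub_apply, AddMonoidHom.smul_apply, AddMonoidHom.id_apply]
    exact sub_mem (hstab L b hb) (AddSubgroup.zsmul_mem _ hb w)

/-- **Independence up to bounded torsion**: an eigenvector `Φ y = w' • y` lying in `∑_{w ∈ L} S_w` is killed by `∏_{w ∈ L} (w' − w)`.
[folklore] -/
theorem prod_smul_eq_zero_of_eigen_of_mem (L : List ℤ) {w' : ℤ} {y : D} (hy : Φ y = w' • y)
    (hmem : y ∈ L.foldr (fun w (H : AddSubgroup D) ↦ (Φ - w • AddMonoidHom.id D).ker ⊔ H) ⊥) :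
    (L.map fun w ↦ w' - w).prod • y = 0 := by
  rw [← foldr_apply_of_eigen Φ L hy]; exact foldr_apply_eq_zero_of_mem Φ L hmem

omit hp in
/-- The product `∏_{w ∈ L} (w' − w)` is non-zero when `w' ∉ L`. [folklore] -/
theorem prod_ne_zero_of_not_mem (L : List ℤ) {w' : ℤ} (hw' : w' ∉ L) : (L.map fun w ↦ w' - w).prod ≠ 0 := by
  induction L with
  | nil => simp
  | cons w L ih =>
    rw [List.map_cons, List.prod_cons]
    exact mul_ne_zero (sub_ne_zero.2 fun h ↦ hw' (h ▸ List.mem_cons_self))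
      (ih fun h ↦ hw' (List.mem_cons_of_mem _ h))

end Summit.BirchSwinnertonDyer.BirchSwinnertonDyer.Theorems.SignedEC.PrimaryTorsionEigen

end
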